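import Summits.Schanuel.Schanuel.Theses.RoyCriterion
import Summits.Schanuel.Schanuel.Theorems.RoyCriterionRoySmallValueDirichletGapDefs
import Literature.NumberTheory.Transcendental.RoySmallValueMain

/-!
# Route `RoyCriterion`, crux `RoySmallValueDirichletGap` (stmt-Schanuel-1050), line
# `two-sided-absorption-transfer` — stub `StubLinksOfOrbits`

We prove the registered stub `stub_linksOfOrbits : HasOrbitLinks ξ η β τ δ → HasLinks ξ η β τ δ`,
the currency bridge of the line: Roy's enemy at a large level `D` (a Galois orbit of algebraic
points of `ℙ²(ℂ)` close to `(1 : ξ : η)`, [Roy2013, §7, Steps 1–4]) is produced by the tree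
(`RoySmallValueMain.lean`) with its own objects — a configuration of zeros
`Z : Roy2013.ZeroConfigK K ι` over the normal number field `K = Roy2013.closureField S ⊂ ℂ`, an
orbit `Z.orb j₀` and its height `orbitHeight Z j₀ = ∑_{j ∈ O} h_K(rep j) / [K : ℚ]` — and recorded
as `IsOrbitLink` / `HasOrbitLinks`; the rest of the line works with the polynomial-free 0-cycle
currency `IsLink` / `HasLinks` (a finite set `P ⊂ ℂ³`, a height parameter `h`, a level `D*`).

**Statement.** An orbit link with constant `C` is a link with the SAME constant `C`, for
`P := (Z.orb j₀).image Z.α`, `h := orbitHeight Z j₀` and the same `D*`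
(`isLink_image_of_isOrbitLink`).

**Proof.** The representatives `Z.α` are pairwise non-proportional (`ZeroConfigK.sep`), hence
`α` is injective (`zeroConfigK_α_injective`), so `#P = #O` and sums over `P` are sums over `O`
(`Finset.card_image_of_injective`, `Finset.sum_image`, `Finset.filter_image`,
`Finset.subset_image_iff`): the chart, positivity, level, size, mass and Step-4 clauses are those of
the orbit link, re-indexed.  The three remaining clauses of `IsLink` are theorems about orbits:
the coordinates lie in the number field `K`, hence are algebraic (`zeroConfigK_isAlgebraic_α`);
`h(O) ≥ 0` since `h_K ≥ 0` (`Height.logHeight_nonneg`); and the Liouville clause is Roy's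
Proposition 2.4 on the orbit, the tree's `ZeroConfigK.orbit_liouville_log'`, re-based at the point
`α_{j₁}` where the integer form does not vanish (orbits form a partition,
`ZeroConfigK.orb_eq_of_mem`; `R(α_j) = R(rep j)` viewed in `ℂ`, `ZeroConfigK.coe_aeval_rep_int`),
the non-vanishing on the whole orbit being `ZeroConfigK.aeval_rep_ne_zero_of_mem_orb` (Galois
conjugation).

**Design.** No definitions; the vocabulary is the line's Defs file
(`RoyCriterionRoySmallValueDirichletGapDefs`).  The bridge is proved for an arbitrary normal number
field `K ⊂ ℂ` and index type `ι`, then specialised to `K = closureField S`, `ι = Fin m`.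

## References

* [Roy2013] D. Roy, *A small value estimate for 𝔾ₐ × 𝔾ₘ*, Mathematika 59 (2013), 333–363
  (arXiv:1301.0663), §7.
-/

-- `Summit.Schanuel.Schanuel.…` is the mandated layout of this single-problem summit (CONVENTIONS §1).
set_option linter.dupNamespace false

noncomputable section

namespace Summit.Schanuel.Schanuel.Theorems.RoyLinks

open Filter MvPolynomial Finset Height
open Literature.NumberTheory.Transcendental
open Literature.NumberTheory.Transcendental.Roy2013
open Summit.Schanuel.Schanuel.Theses.RoyCriterion (RoySmallValueDirichletGap)

/-! ## Stub `StubLinksOfOrbits` -/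

section Bridge

variable {K : IntermediateField ℚ ℂ} {ι : Type*} [Fintype ι]

/-- The representatives of a configuration of zeros are pairwise distinct complex points: they are
even pairwise non-proportional (`ZeroConfigK.sep`). [folklore] -/
theorem zeroConfigK_α_injective (Z : ZeroConfigK K ι) : Function.Injective Z.α := by
  intro i j hij
  by_contra hne
  exact Z.sep i j hne ⟨1, by rw [one_smul]; exact hij.symm⟩

/-- The coordinates of the representatives of a configuration of zeros over a number field
`K ⊂ ℂ` are algebraic numbers (they lie in `K`, `ZeroConfigK.mem`). [folklore] -/
theorem zeroConfigK_isAlgebraic_α [NumberField K] (Z : ZeroConfigK K ι) (i : ι) (k : Fin 3) :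
    IsAlgebraic ℚ (Z.α i k) := by
  have h : IsAlgebraic ℚ (Z.rep i k) := Algebra.IsAlgebraic.isAlgebraic _
  exact IntermediateField.isAlgebraic_iff.mp h

variable [NumberField K] [Normal ℚ K] [DecidableEq ι]

/-- **An orbit link is a link, with the same constant** (Roy's enemy `Z_D` passed from the tree's
orbit currency to the 0-cycle currency): for the orbit `O = Z.orb j₀` of a configuration of zeros
`Z` over a normal number field `K ⊂ ℂ`, the finite set `P := α(O) ⊂ ℂ³` of its (pairwise distinct)
complex representatives with `h := h(O) = ∑_{j∈O} h_K(rep j)/[K:ℚ]` satisfies every clause of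
`IsLink`: chart, positivity, levels, size, mass and Step 4 are the clauses of `IsOrbitLink`
re-indexed along the injection `α : O → P`; `#P = #O`; `h ≥ 0` as `h_K ≥ 0`; the coordinates are
algebraic as they lie in `K`; and the Liouville clause is Roy's Proposition 2.4 on the orbit,
`ZeroConfigK.orbit_liouville_log'` (re-based at the point where the form does not vanish, the orbits
forming a partition, `ZeroConfigK.orb_eq_of_mem`), the non-vanishing on all of `P` being
`ZeroConfigK.aeval_rep_ne_zero_of_mem_orb`. [cite: Roy2013, Prop. 2.4; §7 Step 4 (first display)] -/
theorem isLink_image_of_isOrbitLink {C : ℝ} {ξ η : ℂ} {β τ δ : ℝ} {D Ds : ℕ}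
    (Z : ZeroConfigK K ι) (j₀ : ι) (hOL : IsOrbitLink C ξ η β τ δ D Z j₀ Ds) :
    IsLink C ξ η β τ δ D ((Z.orb j₀).image Z.α) (orbitHeight Z j₀) Ds := by
  obtain ⟨hchart, hpos, hDs1, hDsD, hcard, hht, hmass, hstep4⟩ := hOL
  have hinj : Function.Injective Z.α := zeroConfigK_α_injective Z
  have hcardP : ((Z.orb j₀).image Z.α).card = (Z.orb j₀).card := card_image_of_injective _ hinj
  have hh0 : 0 ≤ orbitHeight Z j₀ :=
    div_nonneg (sum_nonneg fun j _ => logHeight_nonneg _) (Nat.cast_nonneg _)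
  have hfilter : ((Z.orb j₀).image Z.α).filter (IsNear ξ η) =
      ((Z.orb j₀).filter (fun j => IsNear ξ η (Z.α j))).image Z.α := filter_image
  refine ⟨?_, ?_, ?_, ?_, hDs1, hDsD, ?_, hh0, hht, ?_, ?_, ?_⟩
  · -- (chart)
    intro p hp
    obtain ⟨j, hj, rfl⟩ := mem_image.mp hp
    exact hchart j hj
  · -- (alg)
    intro p hp k
    obtain ⟨j, -, rfl⟩ := mem_image.mp hp
    exact zeroConfigK_isAlgebraic_α Z j k
  · -- (pos)
    intro p hp
    obtain ⟨j, hj, rfl⟩ := mem_image.mp hp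
    exact hpos j hj
  · -- `P ≠ ∅`
    exact image_nonempty.mpr ⟨j₀, Z.self_mem_orb j₀⟩
  · -- (size)
    rw [hcardP]; exact hcard
  · -- (Liouville)
    rintro D' R hR ⟨p, hp, hp0⟩
    obtain ⟨j₁, hj₁, rfl⟩ := mem_image.mp hp
    have hrep : aeval (Z.rep j₁) R ≠ 0 := by
      intro h0
      apply hp0
      rw [← Z.coe_aeval_rep_int j₁ R, h0]
      rfl
    have horb : Z.orb j₁ = Z.orb j₀ := Z.orb_eq_of_mem hj₁
    refine ⟨?_, ?_⟩
    · intro q hq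
      obtain ⟨j, hj, rfl⟩ := mem_image.mp hq
      rw [← horb] at hj
      intro h0
      apply Z.aeval_rep_ne_zero_of_mem_orb hj hrep
      apply Subtype.ext
      rw [Z.coe_aeval_rep_int j R, h0]
      rfl
    · have hL := Z.orbit_liouville_log' j₁ hR hrep
      rw [horb] at hL
      rw [sum_image hinj.injOn]
      exact hL
  · -- (mass)
    rw [hfilter, sum_image hinj.injOn, hcardP]
    exact hmass
  · -- (Step 4)
    intro S hS
    rw [hfilter] at hS
    obtain ⟨S', hS'sub, rfl⟩ := subset_image_iff.mp hS
    rw [sum_image hinj.injOn, hcardP]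
    exact hstep4 S' hS'sub

end Bridge

/-- **Links of orbits (currency bridge of line `two-sided-absorption-transfer`).**  An orbit link
(the tree's objects: `ZeroConfigK` over `closureField S`, orbit `Z.orb j₀`, `orbitHeight`) gives a
link in the 0-cycle currency with the same constant: `P := (Z.orb j₀).image Z.α`,
`h := orbitHeight Z j₀`; Liouville's inequality on `P` is `ZeroConfigK.orbit_liouville_log'`.
[cite: Roy2013, Prop. 2.4; §7 Step 4 (first display)] -/
theorem stub_linksOfOrbits (ξ η : ℂ) (β τ δ : ℝ) :
    HasOrbitLinks ξ η β τ δ → HasLinks ξ η β τ δ := by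
  rintro ⟨C, hC, hev⟩
  refine ⟨C, hC, ?_⟩
  filter_upwards [hev] with D hD
  obtain ⟨S, m, Z, j₀, Ds, hOL⟩ := hD
  exact ⟨_, _, Ds, isLink_image_of_isOrbitLink Z j₀ hOL⟩

end Summit.Schanuel.Schanuel.Theorems.RoyLinks

end
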